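import Literature.MathematicalPhysics.QuantumFieldTheory.Balaban1983to89.Beta.CompositionSingular

/-!
# `BalabanUV.Beta.FP.SliceWardKKT` — road «FP» for binder row D1, row **RHOA-11** (MODEL, S) of the owner's `N7-PROOF.v3.3.md` §3 ∕ `LEAVES-FP.md`
# (b2b-balaban-beta-d1-p3 gen 6, rulings R-FP-22∕R-FP-24): THE COVARIANT-SLICE WARD IDENTITIES OF THE BORDERED INVERSE —
# `Γ^{cov}·(slice)·W = W` and `𝓘ᵀ·(slice)·W = 0` FOR GAUGE DIRECTIONS `W` KILLED BY THE INVARIANT HESSIAN AND BY THE CONSTRAINT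

HONEST DEPENDENCY (page 1, mandatory): continuum YM on T⁴ ⇐ BetaPertH ∧ nine spine estimates (0/9 proved); BetaPertH ⇐ (D1) ∧ (D4) ∧ CAP+tail;
G-an2-4 gates asym, D1 and NE2/3/4.  HONEST FRAMING (cell contract, verbatim): «discharging `BetaPertH` makes Bałaban's UV stability UNCONDITIONAL —
a real constructive-QFT result; it is NOT the continuum limit and NOT the Clay problem.»  THIS MODULE is [folklore] block algebra of the bordered inverse
over a field (b12's `CompositionSingular` dictionary `kkt ∕ flucCov ∕ minOp ∕ minOpL ∕ effForm` BY NAME, SINGULAR-`H` form: the only invertibility hypothesis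
is `IsUnit (kkt H Q).det`); it asserts nothing about Bałaban's operators, cites nothing, mints no `Prop` fact, has no `def`; 0 sorry.  On road FP it is the
MODEL of the covariant-slice Ward identity of organisation γ (N7-PROOF v3.3 §3, R-FP-24 (c): RECORDED, not adopted); it identifies NO ghost object
(`(ΠΔ|_{ker Q′})⁻¹ = ConstrainedGhost.Gh` is row RHOA-12's business), proves no letter and no estimate.  NOT `ρ_n` bounded, NOT RHOA-8, NOT hgerm,
NOT D1, NOT BetaPertH, NOT continuum, NOT Clay.

ABSOLUTE RULE (cell charter, verbatim): «No internally-minted statement may enter as a cited fact. Every hypothesis is either kernel-proved in this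
package or a verbatim quotation of a PUBLISHED theorem with page reference. The manuscript(s) under audit are NOT citable for their own disputed
steps — they are the thing under adjudication; programme-internal (2001/route/tribunal) claims are never citable.»

THE MODEL.  Fine form `H := H₀ + S : Matrix ν ν 𝕜` (invariant Hessian `H₀` plus a slice ∕ gauge-fixing term `S`, e.g. `S = D·Π·Dᵀ` — in the Lean text the
projector is called `Pg`, `Π` being a reserved token), constraint
`Q : Matrix μ ν 𝕜`, bordered system `kkt H Q = [[H, Qᵀ],[Q, 0]]` with inverse blocks `Γ := flucCov H Q` (fluctuation covariance, `Γ^{cov}`), `𝓘 := minOp H Q`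
(minimiser ∕ interpolation, `𝓘^{cov}`), `𝓘ᴸ := minOpL H Q` (`= 𝓘ᵀ` for symmetric `H`), `−𝒮 := −effForm H Q`.  GAUGE DIRECTIONS: a matrix `Wm : Matrix ν κ 𝕜` (columns
`= d_Bχ`, `χ ∈ Lie K`) with the two REPAIR-A-shape LETTERS  (hQ) `Q·Wm = 0` («`Q d_Kχ = 0`»: the residual gauge group preserves the average) and
(hH₀) `H₀·Wm = 0` («`Δ₁(B) d_Bχ = 0` on `Lie K`»: the invariant Hessian kills gauge directions).

WHAT IS PROVED (all under `IsUnit (kkt (H₀ + S) Q).det` only).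
* §1 ABSTRACT SLICE: **`flucCov_mul_slice_mul`** `Γ·S·Wm = Wm` (from `Γ·H + 𝓘·Q = 1`, `CompositionSingular.blocks_mul_kkt`), **`minOpL_mul_slice_mul`** `𝓘ᴸ·S·Wm = 0`
  (from `𝓘ᴸ·H = 𝒮·Q`); the MIRROR forms for symmetric data `Wmᵀ·S·Γ = Wmᵀ`, `Wmᵀ·S·𝓘 = 0` (from `H·Γ + Qᵀ·𝓘ᴸ = 1`, `H·𝓘 = Qᵀ·𝒮`, `kkt_mul_blocks`) and
  `𝓘ᵀ·S·Wm = 0` (`minOpL_eq_transpose`); vector forms; COROLLARIES: «the slice sees every gauge direction» (`S·Wm·c = 0 → Wm·c = 0`), and the CONTRACTION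
  form `tr(M·Γ·S·Wm) = tr(M·Wm)` — what a loop with one `Γ^{cov}`-leg running into a slice vertex reads.
* §2 THE COVARIANT SLICE `S := D·Pg·Dᵀ` (`D : Matrix ν σ 𝕜` the gradient on gauge parameters, `Pg : Matrix σ σ 𝕜` the weight∕projector `Π`, `Wm := D·X`, `X : Matrix σ κ 𝕜` spanning
  `Lie K = {χ : Q·D·χ = 0}`; letters `Q·D·X = 0`, `H₀·D·X = 0`): **`flucCov_slice_ward`** `Γ·D·Pg·(Dᵀ·D)·X = D·X` — N7-PROOF v3.3 §3 «`Γ^{cov}·dΠΔ = d` on `ker Q′`»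
  with `Δ := DᵀD` — and **`minOpL_slice_ward`** `𝓘ᴸ·D·Pg·(Dᵀ·D)·X = 0` («`𝓘ᵀ·DΠ(DᵀW) = 0`»), `minOp_transpose_slice_ward` (symmetric data), + the pointwise `χ`-forms.
Provenance: G-an2-4 formalisation swarm seat b2b-balaban-gan24-formalise-leaf-01 gen 49 (cross-lane on road FP, row RHOA-11), 2026-08-20∕21.
-/

namespace Summit.QuantumFields.BalabanUV.Beta.FP.SliceWardKKT

open scoped Matrix
open Matrix
open Literature.MathematicalPhysics.QuantumFieldTheory.Balaban1983to89.Beta.Composition (kkt)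
open Literature.MathematicalPhysics.QuantumFieldTheory.Balaban1983to89.Beta.CompositionSingular (flucCov minOp minOpL effForm
  blocks_mul_kkt kkt_mul_blocks minOpL_eq_transpose)

variable {𝕜 : Type*} [Field 𝕜]
variable {ν μ κ σ : Type*} [Fintype ν] [Fintype μ] [Fintype κ] [Fintype σ] [DecidableEq ν] [DecidableEq μ]

/-! ## §1 The abstract slice: `H = H₀ + S`, gauge directions killed by `H₀` and by `Q` -/

section Abstract

variable {H₀ S : Matrix ν ν 𝕜} {Q : Matrix μ ν 𝕜} {Wm : Matrix ν κ 𝕜}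

omit [Fintype κ] [DecidableEq ν] in
/-- [folklore] on gauge directions the full Hessian acts through the slice alone: `(H₀ + S)·Wm = S·Wm`. -/
theorem add_mul_eq_slice_mul (hH₀ : H₀ * Wm = 0) : (H₀ + S) * Wm = S * Wm := by
  rw [Matrix.add_mul, hH₀, zero_add]

omit [Fintype κ] in
/-- [our object] **THE SLICE WARD IDENTITY FOR THE FLUCTUATION COVARIANCE**: `Γ·S·Wm = Wm` — the covariance `Γ = flucCov (H₀ + S) Q` inverts the slice
term on the gauge directions killed by `H₀` and `Q` (`Γ·H + 𝓘·Q = 1` applied to `Wm`). -/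
theorem flucCov_mul_slice_mul (h : IsUnit (kkt (H₀ + S) Q).det) (hQ : Q * Wm = 0) (hH₀ : H₀ * Wm = 0) :
    flucCov (H₀ + S) Q * S * Wm = Wm := by
  have h1 := (blocks_mul_kkt (H₀ + S) Q h).1
  have e : (flucCov (H₀ + S) Q * (H₀ + S) + minOp (H₀ + S) Q * Q) * Wm = Wm := by rw [h1, Matrix.one_mul]
  rw [Matrix.add_mul, Matrix.mul_assoc, Matrix.mul_assoc, add_mul_eq_slice_mul hH₀, hQ, Matrix.mul_zero, add_zero,
    ← Matrix.mul_assoc] at e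
  exact e

omit [Fintype κ] in
/-- [our object] **THE SLICE WARD IDENTITY FOR THE LEFT MINIMISER**: `𝓘ᴸ·S·Wm = 0` — the (left) interpolation operator annihilates the slice image of the
gauge directions (`𝓘ᴸ·H = 𝒮·Q` applied to `Wm`). -/
theorem minOpL_mul_slice_mul (h : IsUnit (kkt (H₀ + S) Q).det) (hQ : Q * Wm = 0) (hH₀ : H₀ * Wm = 0) :
    minOpL (H₀ + S) Q * S * Wm = 0 := by
  have h3 := (blocks_mul_kkt (H₀ + S) Q h).2.2.1
  have e : minOpL (H₀ + S) Q * (H₀ + S) * Wm = effForm (H₀ + S) Q * Q * Wm := by rw [h3]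
  rw [Matrix.mul_assoc, Matrix.mul_assoc, add_mul_eq_slice_mul hH₀, hQ, Matrix.mul_zero, ← Matrix.mul_assoc] at e
  exact e

omit [Fintype κ] in
/-- [our object] for SYMMETRIC data the left minimiser is `𝓘ᵀ`: **`𝓘ᵀ·S·Wm = 0`** — the form «`𝓘ᵀ·DΠ(DᵀW) = 0`» of the owner's row. -/
theorem minOp_transpose_mul_slice_mul (h : IsUnit (kkt (H₀ + S) Q).det) (hsymm : (H₀ + S)ᵀ = H₀ + S) (hQ : Q * Wm = 0) (hH₀ : H₀ * Wm = 0) :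
    (minOp (H₀ + S) Q)ᵀ * S * Wm = 0 := by
  rw [← (minOpL_eq_transpose (H₀ + S) Q hsymm).1]
  exact minOpL_mul_slice_mul h hQ hH₀

omit [Fintype κ] in
/-- [our object] MIRROR FORM (gauge legs on the left), symmetric data: **`Wmᵀ·S·Γ = Wmᵀ`** (`H·Γ + Qᵀ·𝓘ᴸ = 1` multiplied by `Wmᵀ`, `Wmᵀ·H = (H·Wm)ᵀ = (S·Wm)ᵀ`). -/
theorem transpose_mul_slice_mul_flucCov (h : IsUnit (kkt (H₀ + S) Q).det) (hH₀t : H₀ᵀ = H₀) (hSt : Sᵀ = S) (hQ : Q * Wm = 0) (hH₀ : H₀ * Wm = 0) :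
    Wmᵀ * S * flucCov (H₀ + S) Q = Wmᵀ := by
  have h1 := (kkt_mul_blocks (H₀ + S) Q h).1
  have hW : Wmᵀ * (H₀ + S) = Wmᵀ * S := by
    have e := congrArg Matrix.transpose (add_mul_eq_slice_mul (S := S) hH₀)
    rw [Matrix.transpose_mul, Matrix.transpose_mul, Matrix.transpose_add, hH₀t, hSt] at e
    exact e
  have hWQ : Wmᵀ * Qᵀ = 0 := by rw [← Matrix.transpose_mul, hQ, Matrix.transpose_zero]
  have e : Wmᵀ * ((H₀ + S) * flucCov (H₀ + S) Q + Qᵀ * minOpL (H₀ + S) Q) = Wmᵀ := by rw [h1, Matrix.mul_one]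
  rw [Matrix.mul_add, ← Matrix.mul_assoc, ← Matrix.mul_assoc, hW, hWQ, Matrix.zero_mul, add_zero] at e
  exact e

omit [Fintype κ] in
/-- [our object] MIRROR FORM for the minimiser, symmetric data: **`Wmᵀ·S·𝓘 = 0`** (`H·𝓘 = Qᵀ·𝒮` multiplied by `Wmᵀ`). -/
theorem transpose_mul_slice_mul_minOp (h : IsUnit (kkt (H₀ + S) Q).det) (hH₀t : H₀ᵀ = H₀) (hSt : Sᵀ = S) (hQ : Q * Wm = 0) (hH₀ : H₀ * Wm = 0) :
    Wmᵀ * S * minOp (H₀ + S) Q = 0 := by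
  have h2 := (kkt_mul_blocks (H₀ + S) Q h).2.1
  have hW : Wmᵀ * (H₀ + S) = Wmᵀ * S := by
    have e := congrArg Matrix.transpose (add_mul_eq_slice_mul (S := S) hH₀)
    rw [Matrix.transpose_mul, Matrix.transpose_mul, Matrix.transpose_add, hH₀t, hSt] at e
    exact e
  have hWQ : Wmᵀ * Qᵀ = 0 := by rw [← Matrix.transpose_mul, hQ, Matrix.transpose_zero]
  have e : Wmᵀ * ((H₀ + S) * minOp (H₀ + S) Q) = Wmᵀ * (Qᵀ * effForm (H₀ + S) Q) := by rw [h2]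
  rw [← Matrix.mul_assoc, ← Matrix.mul_assoc, hW, hWQ, Matrix.zero_mul] at e
  exact e

/-- [our object] COROLLARY — **THE SLICE SEES EVERY GAUGE DIRECTION**: if the slice kills a combination of gauge directions, that combination is zero
(`S·Wm·c = 0 ⟹ Wm·c = 0`; the non-degeneracy behind the constrained ghost `(ΠΔ|_{Lie K})⁻¹` — identification NOT made here). -/
theorem mulVec_eq_zero_of_slice (h : IsUnit (kkt (H₀ + S) Q).det) (hQ : Q * Wm = 0) (hH₀ : H₀ * Wm = 0) {c : κ → 𝕜}
    (hc : (S * Wm) *ᵥ c = 0) : Wm *ᵥ c = 0 := by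
  have e : (flucCov (H₀ + S) Q * S * Wm) *ᵥ c = Wm *ᵥ c := by rw [flucCov_mul_slice_mul h hQ hH₀]
  rw [Matrix.mul_assoc, ← Matrix.mulVec_mulVec, hc, Matrix.mulVec_zero] at e
  exact e.symm

/-- [our object] COROLLARY — injectivity version: the slice image `S·Wm` of an independent family of gauge directions is independent. -/
theorem slice_mulVec_injective (h : IsUnit (kkt (H₀ + S) Q).det) (hQ : Q * Wm = 0) (hH₀ : H₀ * Wm = 0)
    (hinj : Function.Injective Wm.mulVec) : Function.Injective (S * Wm).mulVec := by
  intro c c' hcc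
  apply hinj
  have e : (S * Wm) *ᵥ (c - c') = 0 := by rw [Matrix.mulVec_sub, hcc, sub_self]
  have z := mulVec_eq_zero_of_slice h hQ hH₀ e
  rw [Matrix.mulVec_sub, sub_eq_zero] at z
  exact z

/-- [our object] THE CONTRACTION FORM: for any co-leg `M : Matrix κ ν 𝕜`, `tr(M·Γ·S·Wm) = tr(M·Wm)` — a loop in which ONE `Γ^{cov}`-leg runs into the slice vertex
on a gauge direction reads as if the pair (leg, slice vertex) were absent. -/
theorem trace_mul_flucCov_slice (h : IsUnit (kkt (H₀ + S) Q).det) (hQ : Q * Wm = 0) (hH₀ : H₀ * Wm = 0) (M : Matrix κ ν 𝕜) :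
    (M * flucCov (H₀ + S) Q * S * Wm).trace = (M * Wm).trace := by
  rw [Matrix.mul_assoc, Matrix.mul_assoc, ← Matrix.mul_assoc (flucCov (H₀ + S) Q), flucCov_mul_slice_mul h hQ hH₀]

/-- [our object] THE CONTRACTION FORM for the minimiser leg: `tr(M·𝓘ᴸ·S·Wm) = 0` for any `M : Matrix κ μ 𝕜`. -/
theorem trace_mul_minOpL_slice (h : IsUnit (kkt (H₀ + S) Q).det) (hQ : Q * Wm = 0) (hH₀ : H₀ * Wm = 0) (M : Matrix κ μ 𝕜) :
    (M * minOpL (H₀ + S) Q * S * Wm).trace = 0 := by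
  rw [Matrix.mul_assoc, Matrix.mul_assoc, ← Matrix.mul_assoc (minOpL (H₀ + S) Q), minOpL_mul_slice_mul h hQ hH₀, Matrix.mul_zero,
    Matrix.trace_zero]

end Abstract

/-! ### Vector forms (one gauge direction `w = d_Bχ`) -/

section Vector

variable {H₀ S : Matrix ν ν 𝕜} {Q : Matrix μ ν 𝕜} {w : ν → 𝕜}

/-- [our object] vector form: `Γ·(S·w) = w` for a single gauge direction `w` with `Q·w = 0`, `H₀·w = 0`. -/
theorem flucCov_mulVec_slice (h : IsUnit (kkt (H₀ + S) Q).det) (hQ : Q *ᵥ w = 0) (hH₀ : H₀ *ᵥ w = 0) :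
    flucCov (H₀ + S) Q *ᵥ (S *ᵥ w) = w := by
  have hQ' : Q * Matrix.replicateCol Unit w = 0 := by
    rw [← Matrix.replicateCol_mulVec, hQ]; rfl
  have hH₀' : H₀ * Matrix.replicateCol Unit w = 0 := by
    rw [← Matrix.replicateCol_mulVec, hH₀]; rfl
  have e := flucCov_mul_slice_mul h hQ' hH₀'
  rw [Matrix.mul_assoc, ← Matrix.replicateCol_mulVec, ← Matrix.replicateCol_mulVec] at e
  exact Matrix.replicateCol_injective e

/-- [our object] vector form: `𝓘ᴸ·(S·w) = 0`. -/
theorem minOpL_mulVec_slice (h : IsUnit (kkt (H₀ + S) Q).det) (hQ : Q *ᵥ w = 0) (hH₀ : H₀ *ᵥ w = 0) :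
    minOpL (H₀ + S) Q *ᵥ (S *ᵥ w) = 0 := by
  have hQ' : Q * Matrix.replicateCol Unit w = 0 := by
    rw [← Matrix.replicateCol_mulVec, hQ]; rfl
  have hH₀' : H₀ * Matrix.replicateCol Unit w = 0 := by
    rw [← Matrix.replicateCol_mulVec, hH₀]; rfl
  have e := minOpL_mul_slice_mul h hQ' hH₀'
  rw [Matrix.mul_assoc, ← Matrix.replicateCol_mulVec, ← Matrix.replicateCol_mulVec, ← Matrix.replicateCol_zero] at e
  exact Matrix.replicateCol_injective e

end Vector

/-! ## §2 The covariant slice `S = D·Pg·Dᵀ` (`Pg` = the projector `Π` of the memo; `Π` is a reserved token) on `Lie K = {χ : Q·D·χ = 0}` -/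

section Covariant

variable {H₀ : Matrix ν ν 𝕜} {Q : Matrix μ ν 𝕜} {D : Matrix ν σ 𝕜} {Pg : Matrix σ σ 𝕜} {X : Matrix σ κ 𝕜}

omit [Fintype κ] in
/-- [our object] **THE COVARIANT-SLICE WARD IDENTITY** (N7-PROOF v3.3 §3 «`Γ^{cov}·dΠΔ = d` on `ker Q′`», `Δ := DᵀD`): for gauge parameters `X` with
`Q·D·X = 0` and `H₀·D·X = 0`, `flucCov (H₀ + D·Pg·Dᵀ) Q · D·Pg·(Dᵀ·D)·X = D·X`. -/
theorem flucCov_slice_ward (h : IsUnit (kkt (H₀ + D * Pg * Dᵀ) Q).det) (hQ : Q * D * X = 0) (hH₀ : H₀ * D * X = 0) :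
    flucCov (H₀ + D * Pg * Dᵀ) Q * D * Pg * (Dᵀ * D) * X = D * X := by
  have hQ' : Q * (D * X) = 0 := by rw [← Matrix.mul_assoc, hQ]
  have hH₀' : H₀ * (D * X) = 0 := by rw [← Matrix.mul_assoc, hH₀]
  have e := flucCov_mul_slice_mul (S := D * Pg * Dᵀ) h hQ' hH₀'
  simpa only [Matrix.mul_assoc] using e

omit [Fintype κ] in
/-- [our object] **THE COVARIANT-SLICE WARD IDENTITY FOR THE MINIMISER** («`𝓘ᵀ·DΠ(DᵀW) = 0`», left-minimiser form valid without symmetry):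
`minOpL (H₀ + D·Pg·Dᵀ) Q · D·Pg·(Dᵀ·D)·X = 0`. -/
theorem minOpL_slice_ward (h : IsUnit (kkt (H₀ + D * Pg * Dᵀ) Q).det) (hQ : Q * D * X = 0) (hH₀ : H₀ * D * X = 0) :
    minOpL (H₀ + D * Pg * Dᵀ) Q * D * Pg * (Dᵀ * D) * X = 0 := by
  have hQ' : Q * (D * X) = 0 := by rw [← Matrix.mul_assoc, hQ]
  have hH₀' : H₀ * (D * X) = 0 := by rw [← Matrix.mul_assoc, hH₀]
  have e := minOpL_mul_slice_mul (S := D * Pg * Dᵀ) h hQ' hH₀'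
  simpa only [Matrix.mul_assoc] using e

omit [Fintype κ] in
/-- [our object] symmetric data (`H₀ᵀ = H₀`, `Pgᵀ = Pg`): `(minOp (H₀ + D·Pg·Dᵀ) Q)ᵀ · D·Pg·(Dᵀ·D)·X = 0`. -/
theorem minOp_transpose_slice_ward (h : IsUnit (kkt (H₀ + D * Pg * Dᵀ) Q).det) (hH₀t : H₀ᵀ = H₀) (hPgt : Pgᵀ = Pg) (hQ : Q * D * X = 0)
    (hH₀ : H₀ * D * X = 0) : (minOp (H₀ + D * Pg * Dᵀ) Q)ᵀ * D * Pg * (Dᵀ * D) * X = 0 := by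
  have hsymm : (H₀ + D * Pg * Dᵀ)ᵀ = H₀ + D * Pg * Dᵀ := by
    rw [Matrix.transpose_add, hH₀t, Matrix.transpose_mul, Matrix.transpose_mul, Matrix.transpose_transpose, hPgt, ← Matrix.mul_assoc]
  rw [← (minOpL_eq_transpose _ Q hsymm).1]
  exact minOpL_slice_ward h hQ hH₀

/-- [our object] pointwise form on one gauge parameter `χ ∈ Lie K` (`Q·(D·χ) = 0`, `H₀·(D·χ) = 0`):
`flucCov (H₀ + D·Pg·Dᵀ) Q · (D·Pg·Dᵀ)·(D·χ) = D·χ` — «`Γ^{cov}·dΠΔχ = dχ`». -/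
theorem flucCov_slice_ward_mulVec (h : IsUnit (kkt (H₀ + D * Pg * Dᵀ) Q).det) {χ : σ → 𝕜} (hQ : Q *ᵥ (D *ᵥ χ) = 0)
    (hH₀ : H₀ *ᵥ (D *ᵥ χ) = 0) : flucCov (H₀ + D * Pg * Dᵀ) Q *ᵥ ((D * Pg * Dᵀ) *ᵥ (D *ᵥ χ)) = D *ᵥ χ :=
  flucCov_mulVec_slice h hQ hH₀

/-- [our object] pointwise form for the minimiser: `minOpL (H₀ + D·Pg·Dᵀ) Q · (D·Pg·Dᵀ)·(D·χ) = 0`. -/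
theorem minOpL_slice_ward_mulVec (h : IsUnit (kkt (H₀ + D * Pg * Dᵀ) Q).det) {χ : σ → 𝕜} (hQ : Q *ᵥ (D *ᵥ χ) = 0)
    (hH₀ : H₀ *ᵥ (D *ᵥ χ) = 0) : minOpL (H₀ + D * Pg * Dᵀ) Q *ᵥ ((D * Pg * Dᵀ) *ᵥ (D *ᵥ χ)) = 0 :=
  minOpL_mulVec_slice h hQ hH₀

end Covariant

end Summit.QuantumFields.BalabanUV.Beta.FP.SliceWardKKT
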